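import Mathlib
import Summits.Ventures.DiscreteObjects.Mahler.SchinzelTotallyPositive
import Summits.Ventures.DiscreteObjects.Mahler.GraeffeIdentity
import Summits.Ventures.DiscreteObjects.Mahler.CoresCertificateLift

/-!
# Schinzel's theorem, totally real form: `M(P)² ≥ φ^{deg P}` (venture `DiscreteObjects`, target L)

Cell `pub-namedobj`, seat `pub-namedobj-mahler` (gen 8). Framing: lottery ticket; floor = certified
bounds/negative ranges.

[McKee–Smyth, *Around the Unit Circle*, (14.17); Schinzel 1973.]  If `P ∈ ℤ[X]` has all its complex roots
real and `P(0) P(1) P(-1) ≠ 0`, then `φ^{deg P} ≤ M(P)²`, i.e. `M(P) ≥ φ^{deg P / 2}` — in particular a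
totally real algebraic integer `α ≠ 0, ±1` of degree `d` has `M(α) ≥ ((1+√5)/2)^{d/2}`
(`goldenRatio_pow_le_mahlerMeasure_sq_of_totally_real`).

Proof: the Graeffe step.  `P(x)P(-x)` is even, hence `= Q(x²)` with `Q = contract 2 (P·P(-x)) ∈ ℤ[X]`
(`exists_graeffe`); `Q` has degree `deg P`, `Q(0) = P(0)²`, `Q(1) = P(1)P(-1)`, its roots are the squares
`α²  > 0` of the roots of `P`, and `M(Q) = M(P)²` (`GraeffeIdentity`).  Apply the totally positive case
(`SchinzelTotallyPositive`) to `Q`.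
-/

namespace Summit.Ventures.DiscreteObjects.Mahler

open Polynomial Real

/-- **Graeffe root-squaring in `ℤ[X]`.** For every `P ∈ ℤ[X]` there is `Q ∈ ℤ[X]` with
`Q(X²) = P(X) · P(-X)`. -/
theorem exists_graeffe (P : ℤ[X]) : ∃ Q : ℤ[X], Q.comp (X ^ 2) = P * P.comp (-X) := by
  set f : ℤ[X] := P * P.comp (-X) with hf
  -- `f` is even: `f(-X) = f`
  have heven : f.comp (-X) = f := by
    rw [hf, mul_comp, comp_assoc]
    have : ((-X : ℤ[X]).comp (-X)) = X := by simp
    rw [this, comp_X, mul_comm]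
  have hodd : ∀ i : ℕ, f.coeff (2 * i + 1) = 0 := by
    intro i
    have h := coeff_comp_neg_X_odd f i
    rw [heven] at h
    linarith
  refine ⟨contract 2 f, ?_⟩
  rw [← expand_eq_comp_X_pow]
  ext n
  rw [coeff_expand (by norm_num : 0 < 2), coeff_contract (by norm_num)]
  split_ifs with h
  · rw [Nat.div_mul_cancel h]
  · obtain ⟨i, hi⟩ : ∃ i, n = 2 * i + 1 := ⟨n / 2, by omega⟩
    rw [hi, hodd]

/-- **Schinzel's theorem, totally real form** [McKee–Smyth (14.17); Schinzel 1973]: if all complex roots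
of `P ∈ ℤ[X]` are real and `P(0), P(1), P(-1) ≠ 0`, then `φ^{deg P} ≤ M(P)²`. -/
theorem goldenRatio_pow_le_mahlerMeasure_sq_of_totally_real {P : ℤ[X]} (h0 : P.coeff 0 ≠ 0)
    (h1 : P.eval 1 ≠ 0) (hm1 : P.eval (-1) ≠ 0)
    (hreal : ∀ α ∈ (P.map (Int.castRingHom ℂ)).roots, α.im = 0) :
    goldenRatio ^ P.natDegree ≤ intMahlerMeasure P ^ 2 := by
  have hP0 : P ≠ 0 := by rintro rfl; exact h0 (coeff_zero 0)
  have hinj : Function.Injective (Int.castRingHom ℂ) := (Int.castRingHom ℂ).injective_int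
  obtain ⟨Q, hQ⟩ := exists_graeffe P
  have hnegX : (-X : ℤ[X]).natDegree = 1 := by rw [natDegree_neg, natDegree_X]
  have hPc0 : P.comp (-X) ≠ 0 := by
    intro h
    have := congrArg natDegree h
    rw [natDegree_comp, hnegX, mul_one, natDegree_zero] at this
    -- degree 0 and zero polynomial: then P constant... use eval at 0 instead
    have h2 := congrArg (fun q => q.eval 0) h
    simp only [eval_comp, eval_neg, eval_X, neg_zero, eval_zero] at h2
    rw [← coeff_zero_eq_eval_zero] at h2
    exact h0 h2
  have hf0 : P * P.comp (-X) ≠ 0 := mul_ne_zero hP0 hPc0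
  -- degree of `Q`
  have hQdeg : Q.natDegree = P.natDegree := by
    have h := congrArg natDegree hQ
    rw [natDegree_comp, natDegree_X_pow, natDegree_mul hP0 hPc0, natDegree_comp, hnegX, mul_one] at h
    omega
  -- `M(Q) = M(P)²`
  have hMQ : intMahlerMeasure Q = intMahlerMeasure P ^ 2 := by
    rw [← intMahlerMeasure_comp_X_pow_two, hQ, intMahlerMeasure_mul_comp_neg_X]
  -- `Q(0) ≠ 0`, `Q(1) ≠ 0`
  have hQ1 : Q.eval 1 ≠ 0 := by
    have h := congrArg (fun q => q.eval 1) hQ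
    simp only [eval_comp, eval_pow, eval_X, one_pow, eval_mul, eval_neg] at h
    rw [h]
    exact mul_ne_zero h1 hm1
  have hQ0 : Q.coeff 0 ≠ 0 := by
    have h := congrArg (fun q => q.eval 0) hQ
    simp only [eval_comp, eval_pow, eval_X, eval_mul, eval_neg, neg_zero] at h
    rw [zero_pow two_ne_zero] at h
    rw [coeff_zero_eq_eval_zero, h, ← coeff_zero_eq_eval_zero]
    exact mul_ne_zero h0 h0
  -- roots of `Q` over `ℂ` are squares of roots of `P`: positive reals
  have hPC0 : P.map (Int.castRingHom ℂ) ≠ 0 := (Polynomial.map_ne_zero_iff hinj).mpr hP0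
  have hQC0 : Q.map (Int.castRingHom ℂ) ≠ 0 :=
    (Polynomial.map_ne_zero_iff hinj).mpr (by rintro rfl; exact hQ0 (coeff_zero 0))
  have hQC : (Q.map (Int.castRingHom ℂ)).comp (X ^ 2) =
      P.map (Int.castRingHom ℂ) * (P.map (Int.castRingHom ℂ)).comp (-X) := by
    have h := congrArg (Polynomial.map (Int.castRingHom ℂ)) hQ
    rw [map_comp, Polynomial.map_pow, map_X, Polynomial.map_mul, map_comp, Polynomial.map_neg, map_X] at h
    exact h
  have hpos : ∀ β ∈ (Q.map (Int.castRingHom ℂ)).roots, β.im = 0 ∧ 0 < β.re := by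
    intro β hβ
    have hβroot : (Q.map (Int.castRingHom ℂ)).eval β = 0 := (mem_roots hQC0).mp hβ
    obtain ⟨γ, hγ⟩ := IsAlgClosed.exists_pow_nat_eq β (by norm_num : 0 < 2)
    -- `γ` or `-γ` is a root of `P`
    have hfγ : (P.map (Int.castRingHom ℂ)).eval γ * (P.map (Int.castRingHom ℂ)).eval (-γ) = 0 := by
      have h := congrArg (fun q => q.eval γ) hQC
      simp only [eval_comp, eval_pow, eval_X, eval_mul, eval_neg] at h
      rw [hγ, hβroot] at h
      exact h.symm
    have hroot : ∃ α ∈ (P.map (Int.castRingHom ℂ)).roots, α ^ 2 = β := by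
      rcases mul_eq_zero.mp hfγ with h | h
      · exact ⟨γ, (mem_roots hPC0).mpr h, hγ⟩
      · exact ⟨-γ, (mem_roots hPC0).mpr h, by rw [neg_sq, hγ]⟩
    obtain ⟨α, hα, hαβ⟩ := hroot
    have him := hreal α hα
    have hα0 : α ≠ 0 := by
      intro h
      have hr : (P.map (Int.castRingHom ℂ)).eval α = 0 := (mem_roots hPC0).mp hα
      rw [h, eval_map, eval₂_at_zero, eq_intCast, Int.cast_eq_zero] at hr
      exact h0 hr
    have hαre : α = ((α.re : ℝ) : ℂ) := by
      apply Complex.ext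
      · simp
      · simp [him]
    have hre0 : α.re ≠ 0 := by
      intro h
      apply hα0
      rw [hαre, h]; simp
    rw [← hαβ, hαre, ← Complex.ofReal_pow]
    refine ⟨Complex.ofReal_im _, ?_⟩
    rw [Complex.ofReal_re]
    positivity
  have h := goldenRatio_pow_le_mahlerMeasure_of_totally_positive hQ0 hQ1 hpos
  rw [hQdeg, hMQ] at h
  exact h

end Summit.Ventures.DiscreteObjects.Mahler
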